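import Summits.RiemannHypothesis.RiemannHypothesis.Theorems.CCRouteAdapters
import Literature.NumberTheory.ConnesConsani2021.ProlateEigenvaluePolynomialDecay
import HarnessLib

/-!
# Route «ConnesConsaniSemilocal», crux K0 `DensityRegular` (stmt-RiemannHypothesis-19307) — CLOSED, UNCONDITIONALLY

RH-FREE corpus statement, now a tree theorem with NO named-fact input (cell `rh-crit/cc`, seat `rh-crit-cc-iso` g4;
chain of record cc-lead R71 (2) / R88 (1)(iv), t7 g2 08:54:18Z (i)).  K0 says: there is a `C²` function on `ℝ`
agreeing on `[0, ∞)` with the archimedean density `ε ∘ exp` of Connes–Consani 2021 §5 (Lemma 5.2 / Prop. 5.3 /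
App. E–F), the density being stated inline in the route file and identified with the corpus predicate
`IsArchDensity` by the adapter `CCRouteAdapters.densityRegular_iff` (seat g2, p422797).  The corpus side is the
tree theorem `exists_contDiff_isArchDensity_summable_free` (t7 g2, `ProlateEigenvaluePolynomialDecay.lean`
p433298): gm-t16's termwise-`C²` majorant construction `exists_contDiff_isArchDensity_of_summable`
(`ArchDensityOfMajorant.lean`, E9) fed with the UNCONDITIONAL eigenvalue decay
`summable_abs_prolateEigen_mul_sq : Σ_n |λ(n)|·n² < ∞` (Green symmetry of the prolate operator + Wang's
`χ_{2n} > 2n(2n+1)`; no Osipov / Rokhlin–Xiao input).  Hence the theorem below has the route decl as its type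
and no hypothesis: item stmt-RiemannHypothesis-19307 closes `proved`.
WHAT THIS IS NOT: any claim about RH — K0 is one RH-FREE binder of the route's `closes`, whose conclusion
`WeilArchPositivity_soninTrace_fine` (CC2021 eq. (4)) is itself RH-FREE and not RH-detecting; the RH-EQUIVALENT
residual `IsolatedCC` is untouched.  Nothing here bears on the truth of RH.
-/

-- `Summit.RiemannHypothesis.RiemannHypothesis.…` duplicates `RiemannHypothesis` BY DESIGN (D-0017).
set_option linter.dupNamespace false

namespace Summit.RiemannHypothesis.RiemannHypothesis.Theorems.ConnesConsaniSemilocalDensityRegular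

open Literature.NumberTheory.LFunctions Literature.NumberTheory.ConnesConsani2021

/-- RH-FREE. **K0 `DensityRegular` HOLDS** (route «ConnesConsaniSemilocal», item stmt-RiemannHypothesis-19307): a `C²`
archimedean density exists (`exists_contDiff_isArchDensity_summable_free`, t7 g2 ∘ gm-t16 E9), which is the route
item by the K0 transport `CCRouteAdapters.densityRegular_of_isArchDensity`.  The type is LITERALLY the route decl;
no hypothesis. [cite: ConnesConsani2021, Lemma 5.2 / Prop. 5.3 §5 pp. 19–20 (= arXiv Lemma 29 / Prop. 30); App. F Lemma F.1 (= arXiv Lemma 49)] -/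
theorem densityRegular_proof :
    Summit.RiemannHypothesis.RiemannHypothesis.Theses.ConnesConsaniSemilocal.DensityRegular := by
  obtain ⟨G, hG, hGa, -⟩ := exists_contDiff_isArchDensity_summable_free
  exact CCRouteAdapters.densityRegular_of_isArchDensity hG hGa

end Summit.RiemannHypothesis.RiemannHypothesis.Theorems.ConnesConsaniSemilocalDensityRegular
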